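import Mathlib
import Summits.ValiantsHypothesis.ValiantsHypothesis.Theorems.KPlusLogSqLawResolvedAlternatingChain

/-!
# Route «KPlusLogSqLaw», crux `WeakLifting` (stmt-ValiantsHypothesis-19561) — α row, RESOLVED limit:
# flip-set accounting along an alternating word (kernel core of THEOREM A (iii), g17)

HONEST FRAMING.  Helper lemmas (`--supports stmt-ValiantsHypothesis-19561 --as helper`), seat pub-symmetroid-conjb-2 (g17), cell `pub-symmetroid`,
2026-08-28.  Elementary; def-free; resolved (tropical) limit only; nothing here is a root count and nothing bears on `WeakLifting` / `TropicalB` in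
their windows, on Conjecture B (`KPlusLogSqLaw`), on `MatrixDescartes` or on VP ≠ VNP.

CONTENT (paper: HOME/pub-symmetroid-conjb-2/g17/theory/THEORY-NOTE-g17.md §4.7 THEOREM A (iii)).  Same setting as p626562 / p626993 / p627903.  Along a
chain `M₀, M₁, …` of matchings optimal at strictly increasing times of an ALTERNATING word, the flip sets `D_k = M_k ∆ M_{k+1}` are pairwise disjoint;
precisely (`final_card_eq_of_toward`) a toward move raises the budget `Φ(μ) = #{e < N : (e ∈ μ ↔ λ_e > 0)}` by EXACTLY `|μ ∆ μ'|`, so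
(`flip_sum_le_of_alternating`) `Σ_{k<n} |M_k ∆ M_{k+1}| ≤ N`; and (`slope_jump_le_two_mul_flips`) for slopes of modulus ≤ 2 («two speeds») the slope
jump of a toward move is at most twice the number of flips.  With the note's closed layer counts (q̄_opp(a) = 2⌊a/8⌋+1 ≤ |D| for |D| odd and a ≤ 2|D|,
q̄_same(a) = 2⌊(a+4)/8⌋ ≤ |D| for |D| even — integer arithmetic) this gives THEOREM A (iii): Σ_layers q̄ ≤ m − 1 on the alternating class, the tight
class of the resolved door-(A) census (that last arithmetic step is left to the reader of the note; the two inequalities here are its whole input).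
[this seat; elementary]
-/

-- `Summit.ValiantsHypothesis.ValiantsHypothesis.…` repeats a component by the D-0017 layout (single-conjunct summit); the name is mandated.
set_option linter.dupNamespace false

namespace Summit.ValiantsHypothesis.ValiantsHypothesis.Theorems.KPlusLogSqLaw.ResolvedAlternatingFlips

open Finset
open Summit.ValiantsHypothesis.ValiantsHypothesis.Theorems.KPlusLogSqLaw.ResolvedAlternatingChain (toward_of_alternating')

/-- EXACT BUDGET.  A toward move (`μ' \ μ ⊆ {λ > 0}`, `μ \ μ' ⊆ {λ < 0}`) raises `#{e < N : (e ∈ μ ↔ λ_e > 0)}` by exactly the number of flips. -/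
theorem final_card_eq_of_toward (N : ℕ) (lam : ℕ → ℝ) (μ μ' : Finset ℕ) (hμN : μ ⊆ range N) (hμ'N : μ' ⊆ range N)
    (hin : ∀ e ∈ μ' \ μ, 0 < lam e) (hout : ∀ e ∈ μ \ μ', lam e < 0) :
    ((range N).filter fun e => (e ∈ μ' ↔ 0 < lam e)).card =
      ((range N).filter fun e => (e ∈ μ ↔ 0 < lam e)).card + (μ \ μ' ∪ μ' \ μ).card := by
  classical
  have hdisj : Disjoint ((range N).filter fun e => (e ∈ μ ↔ 0 < lam e)) (μ \ μ' ∪ μ' \ μ) := by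
    rw [Finset.disjoint_left]
    intro e he hD
    obtain ⟨_, hiff⟩ := mem_filter.1 he
    rcases mem_union.1 hD with h | h
    · have hneg := hout e h
      have := hiff.1 (mem_sdiff.1 h).1
      linarith
    · have hpos := hin e h
      exact (mem_sdiff.1 h).2 (hiff.2 hpos)
  rw [← card_union_of_disjoint hdisj]
  congr 1
  ext e
  simp only [mem_union, mem_filter, mem_sdiff]
  constructor
  · rintro ⟨heN, hiff⟩
    by_cases heμ : e ∈ μ
    · by_cases heμ' : e ∈ μ'
      · exact Or.inl ⟨heN, ⟨fun _ => hiff.1 heμ', fun _ => heμ⟩⟩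
      · exact Or.inr (Or.inl ⟨heμ, heμ'⟩)
    · by_cases heμ' : e ∈ μ'
      · exact Or.inr (Or.inr ⟨heμ', heμ⟩)
      · exact Or.inl ⟨heN, ⟨fun h => absurd h heμ, fun h => absurd (hiff.2 h) heμ'⟩⟩
  · rintro (⟨heN, hiff⟩ | ⟨heμ, heμ'⟩ | ⟨heμ', heμ⟩)
    · by_cases heμ' : e ∈ μ'
      · have heμ : e ∈ μ := by
          by_contra h
          exact absurd (hiff.2 (hin e (mem_sdiff.2 ⟨heμ', h⟩))) (fun _ => h (hiff.2 (hin e (mem_sdiff.2 ⟨heμ', h⟩))))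
        exact ⟨heN, ⟨fun _ => hiff.1 heμ, fun _ => heμ'⟩⟩
      · have heμ : e ∉ μ := fun h => by
          have := hout e (mem_sdiff.2 ⟨h, heμ'⟩)
          have := hiff.1 h
          linarith
        exact ⟨heN, ⟨fun h => absurd h heμ', fun h => absurd (hiff.2 h) heμ⟩⟩
    · have hneg := hout e (mem_sdiff.2 ⟨heμ, heμ'⟩)
      exact ⟨mem_range.2 (mem_range.1 (hμN heμ)), ⟨fun h => absurd h heμ', fun h => by linarith⟩⟩
    · have hpos := hin e (mem_sdiff.2 ⟨heμ', heμ⟩)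
      exact ⟨mem_range.2 (mem_range.1 (hμ'N heμ')), ⟨fun _ => hpos, fun _ => heμ'⟩⟩

/-- FLIP SETS ARE DISJOINT ALONG AN ALTERNATING CHAIN (THEOREM A (iii), combinatorial input).  Alternating nonzero slopes on `N` edges; `M 0, M 1, …`
matchings with `M k` optimal at time `s k`, `s` strictly increasing on `0..n`.  Then the total number of flips `Σ_{k<n} |M k ∆ M (k+1)|` is at most `N`. -/
theorem flip_sum_le_of_alternating (N : ℕ) (a lam : ℕ → ℝ)
    (halt : ∀ i, i + 1 < N → lam i * lam (i + 1) < 0) (hnz : ∀ i, i < N → lam i ≠ 0)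
    (n : ℕ) (s : ℕ → ℝ) (hs : ∀ k, k < n → s k < s (k + 1)) (M : ℕ → Finset ℕ)
    (hMN : ∀ k, k ≤ n → M k ⊆ range N) (hMm : ∀ k, k ≤ n → ∀ i ∈ M k, i + 1 ∉ M k)
    (hopt : ∀ k, k ≤ n → ∀ ν : Finset ℕ, ν ⊆ range N → (∀ i ∈ ν, i + 1 ∉ ν) →
      ∑ j ∈ ν, a j + s k * ∑ j ∈ ν, lam j ≤ ∑ j ∈ M k, a j + s k * ∑ j ∈ M k, lam j) :
    ∑ k ∈ range n, (M k \ M (k + 1) ∪ M (k + 1) \ M k).card ≤ N := by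
  classical
  -- telescoping: Φ(M k) = Φ(M 0) + Σ_{j<k} |D_j| for k ≤ n
  have key : ∀ k, k ≤ n → ((range N).filter fun e => (e ∈ M k ↔ 0 < lam e)).card =
      ((range N).filter fun e => (e ∈ M 0 ↔ 0 < lam e)).card + ∑ j ∈ range k, (M j \ M (j + 1) ∪ M (j + 1) \ M j).card := by
    intro k
    induction k with
    | zero => intro _; simp
    | succ k ih =>
      intro hk
      have hk' : k ≤ n := by omega
      obtain ⟨hin, hout⟩ := toward_of_alternating' N a lam halt hnz (s k) (s (k + 1)) (hs k (by omega))
        (M k) (M (k + 1)) (hMN k hk') (hMm k hk') (hMN (k + 1) hk) (hMm (k + 1) hk) (hopt k hk') (hopt (k + 1) hk)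
      rw [final_card_eq_of_toward N lam (M k) (M (k + 1)) (hMN k hk') (hMN (k + 1) hk) hin hout, ih hk', sum_range_succ]
      ring
  have hn := key n le_rfl
  have hcard : ((range N).filter fun e => (e ∈ M n ↔ 0 < lam e)).card ≤ N := by
    calc ((range N).filter fun e => (e ∈ M n ↔ 0 < lam e)).card ≤ (range N).card := card_filter_le _ _
      _ = N := card_range N
  omega

/-- SLOPE JUMP VS FLIPS (THEOREM A (iii), metric input).  If every slope has modulus at most `2` («two speeds» `λ ∈ {±1, ±2}` in particular) then a
toward move from `μ` to `μ'` raises the slope `Σ_{k∈μ} λ_k` by at most twice the number of flips. -/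
theorem slope_jump_le_two_mul_flips (N : ℕ) (lam : ℕ → ℝ) (htwo : ∀ i, i < N → |lam i| ≤ 2) (μ μ' : Finset ℕ)
    (hμN : μ ⊆ range N) (hμ'N : μ' ⊆ range N) :
    ∑ k ∈ μ', lam k - ∑ k ∈ μ, lam k ≤ 2 * ((μ \ μ' ∪ μ' \ μ).card : ℝ) := by
  classical
  have h1 : ∑ k ∈ μ', lam k = ∑ k ∈ μ' \ μ, lam k + ∑ k ∈ μ' ∩ μ, lam k := by
    rw [← sum_union (disjoint_sdiff_inter μ' μ), sdiff_union_inter]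
  have h2 : ∑ k ∈ μ, lam k = ∑ k ∈ μ \ μ', lam k + ∑ k ∈ μ ∩ μ', lam k := by
    rw [← sum_union (disjoint_sdiff_inter μ μ'), sdiff_union_inter]
  have h3 : ∑ k ∈ μ' ∩ μ, lam k = ∑ k ∈ μ ∩ μ', lam k := by rw [inter_comm]
  have hdisj : Disjoint (μ \ μ') (μ' \ μ) := by
    rw [Finset.disjoint_left]
    intro e he he'
    exact (mem_sdiff.1 he').2 (mem_sdiff.1 he).1
  have hcard : ((μ \ μ' ∪ μ' \ μ).card : ℝ) = (μ \ μ').card + (μ' \ μ).card := by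
    rw [card_union_of_disjoint hdisj]; push_cast; ring
  have hb1 : ∑ k ∈ μ' \ μ, lam k ≤ 2 * ((μ' \ μ).card : ℝ) := by
    have : ∑ k ∈ μ' \ μ, lam k ≤ ∑ k ∈ μ' \ μ, (2 : ℝ) :=
      sum_le_sum fun j hj => (le_abs_self _).trans (htwo j (mem_range.1 (hμ'N (mem_sdiff.1 hj).1)))
    simpa [sum_const, nsmul_eq_mul, mul_comm] using this
  have hb2 : -(∑ k ∈ μ \ μ', lam k) ≤ 2 * ((μ \ μ').card : ℝ) := by
    have : ∑ k ∈ μ \ μ', -lam k ≤ ∑ k ∈ μ \ μ', (2 : ℝ) :=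
      sum_le_sum fun j hj => (neg_le_abs _).trans (htwo j (mem_range.1 (hμN (mem_sdiff.1 hj).1)))
    simpa [sum_const, nsmul_eq_mul, mul_comm, sum_neg_distrib] using this
  rw [h1, h2, h3, hcard]
  linarith

end Summit.ValiantsHypothesis.ValiantsHypothesis.Theorems.KPlusLogSqLaw.ResolvedAlternatingFlips
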